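/-
Copyright (c) 2026 the pub-hodgecm-mathlib formalisation cell (harness21).  Prover seat hodgecm-mathlib-F0P3a-p04 (g22): line LH4, «DYADIC PAYDOWN» board (LH4-plan (g3)),
brick «DUAL-dy-unr» = ★ p849114 `UnitaryGroup.exists_unipotentDualPieces_antidiagOne_odd` (LH4-p02 (g2)) at an UNRAMIFIED non-split place of any residue characteristic; 2026-09-02.
-/
import Literature.NumberTheory.Rogawski1990.UnipotentOrbitalIntegralLevelPiecesUnramifiedAllCM     -- ★ RANK at every unramified place: `exists_levelPieces_det_classOrbitalIntegral_ne_zero'` (no `2 ∈ 𝒪_w^×`)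
import Literature.NumberTheory.Rogawski1990.ShalikaGermExpansionHoweReduction                    -- ★ p848172 SH-3: `exists_dualPieces_total_of_subtype` (the `↥S`-Kronecker → total adapter)
import Literature.NumberTheory.Automorphic.OrbitalIntegralDualPieces                               -- ★ `exists_dualPieces_of_det_ne_zero` (RANK ⇒ DUAL by matrix inversion)
import Literature.NumberTheory.Rogawski1990.LocalTransferIdentityCoreThreeWaySplit                 -- ★ `smul_placesOver_eq_of_subsingleton`
import Literature.NumberTheory.Automorphic.LocalUnitaryGroupCongr                                  -- ★ `antidiagOne_isHermitian`
import Literature.NumberTheory.Automorphic.LocalUnitaryIntegralLevel                               -- ★ `isUnit_placeForm_antidiagOne`, `unit_placeForm_antidiagOne_mem_glInt`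
import HarnessLib

/-!
# DUAL PIECES for the unipotent orbital integrals of `U(Φ₃)(L⁺_v)` at an UNRAMIFIED non-split place of ANY residue characteristic ([Rogawski1990] §8.1 p. 113 l. 1–6)

Topic `NumberTheory/Rogawski1990`; namespace `Literature.NumberTheory.Rogawski1990`.  THEOREMS ONLY (no definition, no instance, no notation, no named fact, no `sorry`).
Cell `pub/hodgecm-mathlib` (D-0151), crux H413 = `stmt-HodgeConjecture-24833`, line LH4 (closer row `stub_N6ns`); «DYADIC PAYDOWN» board of LH4-plan (g3) (skeleton v1
0447f09394670f4b, organ (D-SH) «Shalika at `Φ₃`, dyadic places», road ‹DUAL-dy›; census LH4-p02 (g2) `DYADIC-CENSUS.v1.md` 78152befe20dff4e §2), brick «DUAL-dy-unr».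

THIS FILE PROVES `UnitaryGroup.exists_unipotentDualPieces_antidiagOne_unramified` = ★ p849114 `UnitaryGroup.exists_unipotentDualPieces_antidiagOne_odd` with the single
hypothesis `IsUnit (2 : 𝒪[w.1.adicCompletion L]) →` REPLACED by `Algebra.IsUnramifiedIn (𝓞 L) v.asIdeal →` (every other byte of the statement identical): for the
quasi-split form `Φ₃ = antidiag(1,1,1)`, at a non-split place `v` (`Subsingleton (PlacesOver L v)`) UNRAMIFIED in `L` — odd or DYADIC — for every finite set `S` of unipotent
classes of `G = U(Φ₃)(L⁺_v)` and every orbital-measure family `mU` admissible on `S` with the Ranga-Rao clause, there are dual pieces `fd u ∈ C_c^∞(G)` (`u ∈ S`):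
`Φ_{mU}(u, fd u) = 1`, `Φ_{mU}(u, fd u′) = 0` for `u ≠ u′`.

THE PROOF (★ glue, the unramified branch of ★ p849114 with one call swapped): `c • w = w` (★ `smul_placesOver_eq_of_subsingleton`); `Φ₃` is hermitian with good reduction
(★ `antidiagOne_isHermitian`, ★ `isUnit_placeForm_antidiagOne`, ★ `unit_placeForm_antidiagOne_mem_glInt`); ★ RANK `exists_levelPieces_det_classOrbitalIntegral_ne_zero'`
(the `2`-free sibling of ★ p848130) gives reference pieces with `det (Φ(u, g_{u′})) ≠ 0`; ★ `exists_dualPieces_of_det_ne_zero` inverts the matrix and ★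
`exists_dualPieces_total_of_subtype` re-dresses the `↥S`-indexed family as a total function.  The ramified (tame) branch of ★ p849114 is NOT re-run here: at a WILD
ramified dyadic `w` there is no skew uniformiser and the self-dual hermitian lattice classification behind ★ RANK-ramified is tame (census (b1)(b2)) — that half stays print.

HONEST LABEL: count-neutral pay-down; HC_CM is proved only modulo the 7 printed citations (2 remaining: hLiu418 = stmt-HodgeConjecture-24832, h413 =
stmt-HodgeConjecture-24833) until rung 0 closes.

## References
* [Rogawski1990] J. D. Rogawski, *Automorphic Representations of Unitary Groups in Three Variables*, Ann. of Math. Stud. 123 (1990): §8.1, proof of Prop. 8.1.1 p. 113 (l. 1–6: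
  «let `f_j ∈ C(G)` be such that `Φ(u_k, f_j) = δ_jk`»); §3.9 Prop. 3.9.1 p. 32 (unipotent classes); §4.9 p. 54.
* [HarishChandra1999AdmissibleDistributions] Harish-Chandra (DeBacker–Sally), *Admissible Invariant Distributions on Reductive p-adic Groups*, ULS 16 (1999), §3.1 p. 17.
* [Serre1979] J.-P. Serre, *Local Fields*, GTM 67 (1979), Ch. V §2 Prop. 3 (`U_F = N U_E` for unramified `E∕F`, every residue characteristic).
-/

set_option autoImplicit false

noncomputable section

open MeasureTheory Measure NumberField IsDedekindDomain Topology Filter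
open Literature.MeasureTheory.Group Literature.NumberTheory.Automorphic Literature.NumberTheory.Automorphic.UnitaryGroup
open Literature.NumberTheory.GaloisRepresentations
open scoped Matrix MatrixGroups ValuativeRel

namespace Literature.NumberTheory.Rogawski1990

set_option maxHeartbeats 400000 in
-- statement-heavy: four instance binders (as ★ p849114)
/-- **‹DUAL› at an UNRAMIFIED non-split place, any residue characteristic** (= ★ `UnitaryGroup.exists_unipotentDualPieces_antidiagOne_odd` with the hypothesis
`2 ∈ 𝒪_w^×` replaced by `v` unramified in `L`): for every finite set `S` of unipotent classes of `U(Φ₃)(L⁺_v)` and every orbital-measure family `mU` admissible on `S` with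
the Ranga-Rao clause there are `fd u ∈ C_c^∞(G)` with `Φ_{mU}(u, fd u) = 1` and `Φ_{mU}(u, fd u′) = 0` (`u ≠ u′`).  Proof: ★ RANK′ (unramified, `2`-free) + ★ matrix inversion +
★ the total re-dress. [cite: Rogawski1990, §8.1 p. 113] [cite: HarishChandra1999AdmissibleDistributions, §3.1 p. 17] [cite: Serre1979, Ch. V §2 Prop. 3] -/
theorem UnitaryGroup.exists_unipotentDualPieces_antidiagOne_unramified :
    ∀ (L : Type) [Field L] [NumberField L] [IsCMField L] (v : HeightOneSpectrum (𝓞 ↥(maximalRealSubfield L))) (w : UnitaryGroup.PlacesOver L v),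
      Subsingleton (UnitaryGroup.PlacesOver L v) → Algebra.IsUnramifiedIn (𝓞 L) v.asIdeal →
      ∀ [MeasurableSpace ((cmDatum L 3 (Matrix.of fun i j : Fin 3 => if i.val + j.val + 1 = 3 then (1 : L) else 0)).Local v)] [BorelSpace ((cmDatum L 3 (Matrix.of fun i j : Fin 3 => if i.val + j.val + 1 = 3 then (1 : L) else 0)).Local v)]
        [∀ γ : ((cmDatum L 3 (Matrix.of fun i j : Fin 3 => if i.val + j.val + 1 = 3 then (1 : L) else 0)).Local v), MeasurableSpace (((cmDatum L 3 (Matrix.of fun i j : Fin 3 => if i.val + j.val + 1 = 3 then (1 : L) else 0)).Local v) ⧸ Subgroup.centralizer ({γ} : Set ((cmDatum L 3 (Matrix.of fun i j : Fin 3 => if i.val + j.val + 1 = 3 then (1 : L) else 0)).Local v)))]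
        [∀ γ : ((cmDatum L 3 (Matrix.of fun i j : Fin 3 => if i.val + j.val + 1 = 3 then (1 : L) else 0)).Local v), BorelSpace (((cmDatum L 3 (Matrix.of fun i j : Fin 3 => if i.val + j.val + 1 = 3 then (1 : L) else 0)).Local v) ⧸ Subgroup.centralizer ({γ} : Set ((cmDatum L 3 (Matrix.of fun i j : Fin 3 => if i.val + j.val + 1 = 3 then (1 : L) else 0)).Local v)))],
      ∀ (S : Finset (ConjClasses ((cmDatum L 3 (Matrix.of fun i j : Fin 3 => if i.val + j.val + 1 = 3 then (1 : L) else 0)).Local v))) (mU : OrbitalMeasureFamily ((cmDatum L 3 (Matrix.of fun i j : Fin 3 => if i.val + j.val + 1 = 3 then (1 : L) else 0)).Local v)),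
        (∀ u ∈ S, (((Quotient.out u : ((cmDatum L 3 (Matrix.of fun i j : Fin 3 => if i.val + j.val + 1 = 3 then (1 : L) else 0)).Local v)).val : GL (Fin 3) (UnitaryGroup.LocalRing L v)).val - 1) ^ 3 = 0) →
        mU.IsAdmissibleOn (fun γ : ((cmDatum L 3 (Matrix.of fun i j : Fin 3 => if i.val + j.val + 1 = 3 then (1 : L) else 0)).Local v) => (ConjClasses.mk γ) ∈ S) →
        (∀ u ∈ S, ∀ f : ((cmDatum L 3 (Matrix.of fun i j : Fin 3 => if i.val + j.val + 1 = 3 then (1 : L) else 0)).Local v) → ℂ, IsLocSmooth f →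
            Integrable (descConj (Quotient.out u : ((cmDatum L 3 (Matrix.of fun i j : Fin 3 => if i.val + j.val + 1 = 3 then (1 : L) else 0)).Local v)) (Subgroup.centralizer ({(Quotient.out u : ((cmDatum L 3 (Matrix.of fun i j : Fin 3 => if i.val + j.val + 1 = 3 then (1 : L) else 0)).Local v))} : Set ((cmDatum L 3 (Matrix.of fun i j : Fin 3 => if i.val + j.val + 1 = 3 then (1 : L) else 0)).Local v)))
              (fun _ hg => Subgroup.mem_centralizer_singleton_iff.1 hg) f) (mU u)) →
        ∃ fd : ConjClasses ((cmDatum L 3 (Matrix.of fun i j : Fin 3 => if i.val + j.val + 1 = 3 then (1 : L) else 0)).Local v) → ((cmDatum L 3 (Matrix.of fun i j : Fin 3 => if i.val + j.val + 1 = 3 then (1 : L) else 0)).Local v) → ℂ,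
          (∀ u ∈ S, IsLocSmooth (fd u)) ∧ (∀ u ∈ S, classOrbitalIntegral mU (fd u) u = 1) ∧
          (∀ u ∈ S, ∀ u' ∈ S, u ≠ u' → classOrbitalIntegral mU (fd u') u = 0) := by
  intro L _ _ _ v w hsub hv _ _ _ _ S mU hS hmU hRao
  classical
  have hw : IsCMField.complexConj L • w.1 = w.1 := smul_placesOver_eq_of_subsingleton L v (IsCMField.complexConj L) hsub w
  -- `Φ₃` is hermitian with good reduction at `w`
  have hH' := antidiagOne_isHermitian L 3
  have hH'w := isUnit_placeForm_antidiagOne (E := L) 3 w.1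
  have hH'i := unit_placeForm_antidiagOne_mem_glInt (E := L) 3 w.1
  -- the reference pieces with invertible orbital-integral matrix (★ RANK′, unramified, any residue characteristic)
  obtain ⟨gref, hgs, -, -, -, hdet⟩ :=
    exists_levelPieces_det_classOrbitalIntegral_ne_zero' L _ hH' w hw hv hH'w hH'i S hS mU hmU hRao
  -- invert: Kronecker dual pieces on `↥S`, then the total dress
  obtain ⟨fdS, hfdS, hkron, -⟩ := exists_dualPieces_of_det_ne_zero S mU hRao gref hgs hdet
  exact exists_dualPieces_total_of_subtype S mU fdS hfdS (fun u => by simpa using hkron u u)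
    (fun u u' hne => by simpa [if_neg hne] using hkron u u')

end Literature.NumberTheory.Rogawski1990

end
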